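import Summits.QuantumFields.YangMills.Theses.ParabolicTrajectory
import Literature.MathematicalPhysics.QuantumFieldTheory.LatticeGaugeProofs
import Literature.Probability.LatticeModels.ProductMeasureTools

/-!
# `ContinuumLimitOnTrajectory` — negative-side support I: the torus Haar trick at zero coupling

Support file 1/4 for crux `stmt-QuantumFields-10522` (`ParabolicTrajectory.ContinuumLimitOnTrajectory`, (A)),
extracted from the standing disprover's work file `Cruxes/ContinuumLimitOnTrajectory/Disproof.lean` §2
(cdisprove gen 2). Tree objects only (`plaquetteHolonomy`, `haarProbability`, `actionDensity`, `torusLift`,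
`configShift`); nothing is posited.

* `torusDensity`, `actionDensity_shift_torusLift`: the Wilson action density of the shifted periodic lift in
  torus variables.
* `plaquette_update`, `integral_update_plaquette` (Haar invariance over one bond, torus version of the tree's
  `integral_update_plaquette` on `ℤ^d`), `integral_comp_plaquette` (plaquette variables are Haar distributed
  under product Haar), `exists_private_edge`, `integral_plaquette_mul_plaquette`: plaquette variables at
  DISTINCT base points are uncorrelated under product Haar — even when the plaquettes share a bond.
* `integral_torusDensity`, `integral_torusDensity_mul`: the densities at distinct torus sites are uncorrelated.
-/

namespace Summit.QuantumFields.YangMills.Theorems.ContinuumLimitOnTrajectory.Negative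

open MeasureTheory Filter Topology
open Literature.MathematicalPhysics.QuantumFieldTheory Literature.MathematicalPhysics.QuantumLattice
open Literature.Probability.LatticeModels (Torus.proj Torus.proj_apply)

noncomputable section

section Density

variable {G : Type} [Group G] {N : ℕ} (ρ : G →* Matrix (Fin N) (Fin N) ℂ) (S : ℕ)

/-- The Wilson action density at the torus site `x`: `∑_{i<j} Re tr ρ(U_{(x,i,j)})`. [folklore] -/
def torusDensity (x : Site 4 S) (U : GaugeConfig 4 S G) : ℝ :=
  ∑ p : Fin 4 × Fin 4, if p.1 < p.2 then (ρ (plaquetteHolonomy U x p.1 p.2)).trace.re else 0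

/-- `Torus.proj` is additive. [folklore] -/
theorem proj_add (v w : Literature.Probability.LatticeModels.Site 4) :
    Torus.proj S (v + w) = Torus.proj S v + Torus.proj S w := by
  funext i; simp

/-- `Torus.proj` of a coordinate vector. [folklore] -/
theorem proj_single (i : Fin 4) (z : ℤ) :
    Torus.proj S (Pi.single i z) = Pi.single i (z : ZMod S) := by
  funext k; by_cases h : k = i
  · subst h; simp
  · simp [h]

/-- `Torus.proj 0 = 0`. [folklore] -/
theorem proj_zero : Torus.proj S (0 : Literature.Probability.LatticeModels.Site 4) = 0 := by
  funext k; simp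

/-- Plaquette holonomy of the periodic lift, shifted by `v`, at the origin = torus holonomy at
`proj v`. [folklore] -/
theorem plaquetteHolonomyZd_shift_torusLift [MeasurableSpace G]
    (v : Literature.Probability.LatticeModels.Site 4) (U : GaugeConfig 4 S G) (i j : Fin 4) :
    plaquetteHolonomyZd (configShift (-v) (torusLift S U)) 0 i j =
      plaquetteHolonomy U (Torus.proj S v) i j := by
  simp only [plaquetteHolonomyZd, configShift_apply, torusLift, Function.comp_apply, torusEdge,
    plaquetteHolonomy, Site.shift, sub_neg_eq_add, zero_add, proj_add, proj_single, Int.cast_one,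
    add_comm (Torus.proj S v)]

/-- The shifted curvature density of the periodic lift is the torus density at the projected shift. [folklore] -/
theorem actionDensity_shift_torusLift [MeasurableSpace G]
    (v : Literature.Probability.LatticeModels.Site 4) (U : GaugeConfig 4 S G) :
    actionDensity ρ (configShift (-v) (torusLift S U)) = torusDensity ρ S (Torus.proj S v) U := by
  simp only [actionDensity, torusDensity, plaquetteObs, plaquetteHolonomyZd_shift_torusLift,
    Fintype.sum_prod_type]

/-- The curvature density of the periodic lift is the torus density at the origin. [folklore] -/
theorem actionDensity_torusLift [MeasurableSpace G] (U : GaugeConfig 4 S G) :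
    actionDensity ρ (torusLift S U) = torusDensity ρ S 0 U := by
  have h := actionDensity_shift_torusLift ρ S 0 U
  rw [proj_zero] at h
  rw [← h]
  congr 1
  funext e
  simp [configShift_apply]

end Density

section Combinatorics

variable {G : Type} [Group G] (S : ℕ)

/-- A unit step moves every torus site (`S ≠ 1`). [folklore] -/
theorem shift_ne_self (hS : (1 : ZMod S) ≠ 0) (x : Site 4 S) (k : Fin 4) : x.shift k ≠ x := by
  intro h
  have := congrFun h k
  simp [Site.shift, hS] at this

/-- Unit steps in different directions differ (`S ≠ 1`). [folklore] -/
theorem shift_ne_shift (hS : (1 : ZMod S) ≠ 0) (x : Site 4 S) {i j : Fin 4} (hij : i ≠ j) :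
    x.shift i ≠ x.shift j := by
  intro h
  have := congrFun h i
  simp [Site.shift, hS, hij] at this

/-- Updating a link not on the plaquette does not change its holonomy. [folklore] -/
theorem plaquetteHolonomy_update_of_ne (x : Site 4 S) (i j : Fin 4) (U : GaugeConfig 4 S G)
    {e : Edge 4 S} (h1 : e ≠ (x, i)) (h2 : e ≠ (x.shift i, j)) (h3 : e ≠ (x.shift j, i))
    (h4 : e ≠ (x, j)) (g : G) :
    plaquetteHolonomy (Function.update U e g) x i j = plaquetteHolonomy U x i j := by
  simp only [plaquetteHolonomy, Function.update_of_ne h1.symm, Function.update_of_ne h2.symm,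
    Function.update_of_ne h3.symm, Function.update_of_ne h4.symm]

/-- The torus plaquette holonomy after updating one of its four bonds (`S ≠ 1`, `i ≠ j`). [folklore] -/
theorem plaquette_update (hS : (1 : ZMod S) ≠ 0) (x : Site 4 S) {i j : Fin 4} (hij : i ≠ j)
    (U : GaugeConfig 4 S G) (g : G) :
    plaquetteHolonomy (Function.update U (x, i) g) x i j =
        g * U (x.shift i, j) * (U (x.shift j, i))⁻¹ * (U (x, j))⁻¹ ∧
    plaquetteHolonomy (Function.update U (x.shift i, j) g) x i j =
        U (x, i) * g * (U (x.shift j, i))⁻¹ * (U (x, j))⁻¹ ∧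
    plaquetteHolonomy (Function.update U (x.shift j, i) g) x i j =
        U (x, i) * U (x.shift i, j) * g⁻¹ * (U (x, j))⁻¹ ∧
    plaquetteHolonomy (Function.update U (x, j) g) x i j =
        U (x, i) * U (x.shift i, j) * (U (x.shift j, i))⁻¹ * g⁻¹ := by
  have hx : ∀ k : Fin 4, x.shift k ≠ x := shift_ne_self S hS x
  have h12 : ((x, i) : Edge 4 S) ≠ (x.shift i, j) := fun h => hx i (Prod.ext_iff.1 h).1.symm
  have h13 : ((x, i) : Edge 4 S) ≠ (x.shift j, i) := fun h => hx j (Prod.ext_iff.1 h).1.symm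
  have h14 : ((x, i) : Edge 4 S) ≠ (x, j) := fun h => hij (Prod.ext_iff.1 h).2
  have h23 : ((x.shift i, j) : Edge 4 S) ≠ (x.shift j, i) :=
    fun h => hij ((Prod.ext_iff.1 h).2).symm
  have h24 : ((x.shift i, j) : Edge 4 S) ≠ (x, j) := fun h => hx i (Prod.ext_iff.1 h).1
  have h34 : ((x.shift j, i) : Edge 4 S) ≠ (x, j) := fun h => hx j (Prod.ext_iff.1 h).1
  simp only [plaquetteHolonomy, Function.update_self, Function.update_of_ne h12.symm,
    Function.update_of_ne h13.symm, Function.update_of_ne h14.symm, Function.update_of_ne h12,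
    Function.update_of_ne h23.symm, Function.update_of_ne h24.symm, Function.update_of_ne h13,
    Function.update_of_ne h23, Function.update_of_ne h34.symm, Function.update_of_ne h14,
    Function.update_of_ne h24, Function.update_of_ne h34, and_self]

/-- A private bond: for base points `x ≠ y` every plaquette at `y` has a bond not on a given
plaquette at `x`. [folklore] -/
theorem exists_private_edge (hS : (1 : ZMod S) ≠ 0) {x y : Site 4 S} (hxy : x ≠ y)
    {i j k l : Fin 4} (hij : i ≠ j) (hkl : k ≠ l) :
    ∃ e : Edge 4 S, (e = (y, k) ∨ e = (y.shift k, l) ∨ e = (y.shift l, k) ∨ e = (y, l)) ∧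
      e ≠ (x, i) ∧ e ≠ (x.shift i, j) ∧ e ≠ (x.shift j, i) ∧ e ≠ (x, j) := by
  have hne2 : ∀ {a b : Site 4 S} {m m' : Fin 4}, m ≠ m' → ((a, m) : Edge 4 S) ≠ (b, m') :=
    fun h h' => h (Prod.ext_iff.1 h').2
  have hne1 : ∀ {a b : Site 4 S} {m m' : Fin 4}, a ≠ b → ((a, m) : Edge 4 S) ≠ (b, m') :=
    fun h h' => h (Prod.ext_iff.1 h').1
  by_cases hk : k ≠ i ∧ k ≠ j
  · exact ⟨(y, k), Or.inl rfl, hne2 hk.1, hne2 hk.2, hne2 hk.1, hne2 hk.2⟩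
  by_cases hl : l ≠ i ∧ l ≠ j
  · exact ⟨(y, l), Or.inr (Or.inr (Or.inr rfl)), hne2 hl.1, hne2 hl.2, hne2 hl.1, hne2 hl.2⟩
  -- now `k, l ∈ {i, j}`; one of them is `i`, one of them is `j`
  have hk' : k = i ∨ k = j := by tauto
  have hl' : l = i ∨ l = j := by tauto
  by_cases hy : y = x.shift j
  · -- use the bond of `q` based at `y` in direction `j`
    have key : ∀ e : Edge 4 S, e = (y, j) →
        e ≠ (x, i) ∧ e ≠ (x.shift i, j) ∧ e ≠ (x.shift j, i) ∧ e ≠ (x, j) := by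
      rintro e rfl
      refine ⟨hne2 hij.symm, hne1 ?_, hne2 hij.symm, hne1 ?_⟩
      · rw [hy]; exact (shift_ne_shift S hS x hij).symm
      · rw [hy]; exact shift_ne_self S hS x j
    rcases hk' with rfl | rfl
    · rcases hl' with rfl | rfl
      · exact absurd rfl hkl
      · exact ⟨(y, l), Or.inr (Or.inr (Or.inr rfl)), key _ rfl⟩
    · exact ⟨(y, k), Or.inl rfl, key _ rfl⟩
  · -- use the bond of `q` based at `y` in direction `i`
    have key : ∀ e : Edge 4 S, e = (y, i) →
        e ≠ (x, i) ∧ e ≠ (x.shift i, j) ∧ e ≠ (x.shift j, i) ∧ e ≠ (x, j) := by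
      rintro e rfl
      exact ⟨hne1 (Ne.symm hxy), hne2 hij, hne1 hy, hne2 hij⟩
    rcases hk' with rfl | rfl
    · exact ⟨(y, k), Or.inl rfl, key _ rfl⟩
    · rcases hl' with rfl | rfl
      · exact ⟨(y, l), Or.inr (Or.inr (Or.inr rfl)), key _ rfl⟩
      · exact absurd rfl hkl

end Combinatorics

section Haar

variable {G : Type} [Group G] [TopologicalSpace G] [IsTopologicalGroup G] [CompactSpace G]
  [MeasurableSpace G] [BorelSpace G] (S : ℕ) [NeZero S]

/-- Product Haar measure on torus gauge configurations. [folklore] -/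
abbrev piHaar : Measure (GaugeConfig 4 S G) := Measure.pi fun _ : Edge 4 S => haarProbability G

omit [NeZero S] in
/-- **Haar invariance over one bond** (torus version of `integral_update_plaquette`). [folklore] -/
theorem integral_update_plaquette {E : Type*} [NormedAddCommGroup E] [NormedSpace ℝ E]
    (hS : (1 : ZMod S) ≠ 0) {Φ : G → E} (hΦ : Continuous Φ) (x : Site 4 S) {i j : Fin 4}
    (hij : i ≠ j) (U : GaugeConfig 4 S G) {e : Edge 4 S}
    (he : e = (x, i) ∨ e = (x.shift i, j) ∨ e = (x.shift j, i) ∨ e = (x, j)) :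
    Integrable (fun g => Φ (plaquetteHolonomy (Function.update U e g) x i j)) (haarProbability G) ∧
      ∫ g, Φ (plaquetteHolonomy (Function.update U e g) x i j) ∂haarProbability G =
        ∫ g, Φ g ∂haarProbability G := by
  have hint : ∀ {ψ : G → E}, Continuous ψ → Integrable ψ (haarProbability G) := fun hψ =>
    hψ.integrable_of_hasCompactSupport (HasCompactSupport.of_compactSpace _)
  rcases he with rfl | rfl | rfl | rfl
  · have hupd : ∀ g, plaquetteHolonomy (Function.update U (x, i) g) x i j =
        1 * g * (U (x.shift i, j) * (U (x.shift j, i))⁻¹ * (U (x, j))⁻¹) :=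
      fun g => by rw [(plaquette_update S hS x hij U g).1]; simp [mul_assoc]
    simp_rw [hupd]
    exact ⟨hint (hΦ.comp ((continuous_const.mul continuous_id).mul continuous_const)),
      integral_haar_conj_eq Φ _ _⟩
  · have hupd : ∀ g, plaquetteHolonomy (Function.update U (x.shift i, j) g) x i j =
        U (x, i) * g * ((U (x.shift j, i))⁻¹ * (U (x, j))⁻¹) :=
      fun g => by rw [(plaquette_update S hS x hij U g).2.1]; simp [mul_assoc]
    simp_rw [hupd]
    exact ⟨hint (hΦ.comp ((continuous_const.mul continuous_id).mul continuous_const)),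
      integral_haar_conj_eq Φ _ _⟩
  · have hupd : ∀ g, plaquetteHolonomy (Function.update U (x.shift j, i) g) x i j =
        U (x, i) * U (x.shift i, j) * g⁻¹ * (U (x, j))⁻¹ :=
      fun g => (plaquette_update S hS x hij U g).2.2.1
    simp_rw [hupd]
    exact ⟨hint (hΦ.comp ((continuous_const.mul continuous_inv).mul continuous_const)),
      integral_haar_conj_inv_eq Φ _ _⟩
  · have hupd : ∀ g, plaquetteHolonomy (Function.update U (x, j) g) x i j =
        U (x, i) * U (x.shift i, j) * (U (x.shift j, i))⁻¹ * g⁻¹ * 1 :=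
      fun g => by rw [(plaquette_update S hS x hij U g).2.2.2, mul_one]
    simp_rw [hupd]
    exact ⟨hint (hΦ.comp ((continuous_const.mul continuous_inv).mul continuous_const)),
      integral_haar_conj_inv_eq Φ _ _⟩

/-- Resampling one coordinate of a finite product of probability measures. [folklore] -/
theorem integral_pi_eq_integral_update {ι : Type*} [Fintype ι] [DecidableEq ι] {X : ι → Type*}
    [∀ i, MeasurableSpace (X i)] (μ : (i : ι) → Measure (X i)) [∀ i, IsProbabilityMeasure (μ i)]
    (i₀ : ι) {F : (Π i, X i) → ℝ} (hF : Integrable F (Measure.pi μ)) :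
    ∫ x, F x ∂Measure.pi μ = ∫ x, ∫ y, F (Function.update x i₀ y) ∂μ i₀ ∂Measure.pi μ := by
  rw [← Measure.infinitePi_eq_pi] at hF ⊢
  exact Literature.Probability.LatticeModels.integral_infinitePi_eq_integral_update μ i₀ hF

variable [SecondCountableTopology G]

omit [CompactSpace G] [MeasurableSpace G] [BorelSpace G] [SecondCountableTopology G] [NeZero S] in
/-- The torus plaquette holonomy is continuous in the configuration. [folklore] -/
theorem continuous_plaquetteHolonomy (x : Site 4 S) (i j : Fin 4) :
    Continuous fun U : GaugeConfig 4 S G => plaquetteHolonomy U x i j := by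
  unfold plaquetteHolonomy; fun_prop

/-- Continuous functions on the compact configuration space are integrable for product Haar. [folklore] -/
theorem integrable_of_continuous {F : GaugeConfig 4 S G → ℝ} (hF : Continuous F) :
    Integrable F (piHaar S (G := G)) :=
  hF.integrable_of_hasCompactSupport (HasCompactSupport.of_compactSpace _)

/-- **The plaquette variable is Haar distributed** under the product Haar measure on the torus. [folklore] -/
theorem integral_comp_plaquette (hS : (1 : ZMod S) ≠ 0) {Φ : G → ℝ} (hΦ : Continuous Φ)
    (x : Site 4 S) {i j : Fin 4} (hij : i ≠ j) :
    ∫ U, Φ (plaquetteHolonomy U x i j) ∂piHaar S = ∫ g, Φ g ∂haarProbability G := by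
  classical
  have hint : Integrable (fun U : GaugeConfig 4 S G => Φ (plaquetteHolonomy U x i j)) (piHaar S) :=
    integrable_of_continuous S (hΦ.comp (continuous_plaquetteHolonomy S x i j))
  rw [piHaar, integral_pi_eq_integral_update (fun _ : Edge 4 S => haarProbability G) ((x, i) : Edge 4 S) hint]
  have hupd : ∀ U : GaugeConfig 4 S G,
      ∫ g, Φ (plaquetteHolonomy (Function.update U (x, i) g) x i j) ∂haarProbability G =
        ∫ g, Φ g ∂haarProbability G := fun U =>
    (integral_update_plaquette S hS hΦ x hij U (e := (x, i)) (Or.inl rfl)).2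
  simp_rw [hupd]
  rw [integral_const, probReal_univ, one_smul]

/-- **Distinct base points carry uncorrelated plaquette variables** under product Haar. [folklore] -/
theorem integral_plaquette_mul_plaquette (hS : (1 : ZMod S) ≠ 0) {Φ Ψ : G → ℝ}
    (hΦ : Continuous Φ) (hΨ : Continuous Ψ) {x y : Site 4 S} (hxy : x ≠ y) {i j k l : Fin 4}
    (hij : i ≠ j) (hkl : k ≠ l) :
    ∫ U, Φ (plaquetteHolonomy U x i j) * Ψ (plaquetteHolonomy U y k l) ∂piHaar S =
      (∫ g, Φ g ∂haarProbability G) * ∫ g, Ψ g ∂haarProbability G := by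
  classical
  obtain ⟨e, he, h1, h2, h3, h4⟩ := exists_private_edge S hS hxy hij hkl
  have hint : Integrable (fun U : GaugeConfig 4 S G =>
      Φ (plaquetteHolonomy U x i j) * Ψ (plaquetteHolonomy U y k l)) (piHaar S) :=
    integrable_of_continuous S ((hΦ.comp (continuous_plaquetteHolonomy S x i j)).mul
      (hΨ.comp (continuous_plaquetteHolonomy S y k l)))
  rw [piHaar, integral_pi_eq_integral_update (fun _ : Edge 4 S => haarProbability G) e hint]
  have hupd : ∀ U : GaugeConfig 4 S G,
      ∫ g, Φ (plaquetteHolonomy (Function.update U e g) x i j) *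
          Ψ (plaquetteHolonomy (Function.update U e g) y k l) ∂haarProbability G =
        Φ (plaquetteHolonomy U x i j) * ∫ g, Ψ g ∂haarProbability G := fun U => by
    simp_rw [plaquetteHolonomy_update_of_ne S x i j U h1 h2 h3 h4]
    rw [integral_const_mul, (integral_update_plaquette S hS hΨ y hkl U he).2]
  simp_rw [hupd]
  rw [integral_mul_const, ← piHaar, integral_comp_plaquette S hS hΦ x hij]

end Haar

section Correlator

variable {G : Type} [Group G] [TopologicalSpace G] [IsTopologicalGroup G] [CompactSpace G]
  [MeasurableSpace G] [BorelSpace G] [SecondCountableTopology G]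
  {N : ℕ} (ρ : G →* Matrix (Fin N) (Fin N) ℂ) (S : ℕ) [NeZero S]

/-- The Haar mean of the character, `m_ρ = ∫_G Re tr ρ(g) dg`. [folklore] -/
def charMean : ℝ := ∫ g, (ρ g).trace.re ∂haarProbability G

/-- One (possibly switched-off) plaquette term of the density. [folklore] -/
def plaqTerm (x : Site 4 S) (p : Fin 4 × Fin 4) (U : GaugeConfig 4 S G) : ℝ :=
  if p.1 < p.2 then (ρ (plaquetteHolonomy U x p.1 p.2)).trace.re else 0

omit [NeZero S] [CompactSpace G] [MeasurableSpace G] [BorelSpace G] [SecondCountableTopology G] in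
/-- Each plaquette term is continuous. [folklore] -/
theorem continuous_plaqTerm (hρ : Continuous ρ) (x : Site 4 S) (p : Fin 4 × Fin 4) :
    Continuous (plaqTerm ρ S x p) := by
  unfold plaqTerm
  by_cases h : p.1 < p.2
  · simp only [h, ↓reduceIte]
    exact (continuous_trace_re ρ hρ).comp (continuous_plaquetteHolonomy S x p.1 p.2)
  · simp only [h, ↓reduceIte]; exact continuous_const

omit [NeZero S] [TopologicalSpace G] [IsTopologicalGroup G] [CompactSpace G] [MeasurableSpace G]
  [BorelSpace G] [SecondCountableTopology G] in
/-- The density as the sum of its plaquette terms. [folklore] -/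
theorem torusDensity_eq_sum (x : Site 4 S) (U : GaugeConfig 4 S G) :
    torusDensity ρ S x U = ∑ p : Fin 4 × Fin 4, plaqTerm ρ S x p U := rfl

/-- Mean of one plaquette term. [folklore] -/
theorem integral_plaqTerm (hS : (1 : ZMod S) ≠ 0) (hρ : Continuous ρ) (x : Site 4 S)
    (p : Fin 4 × Fin 4) :
    ∫ U, plaqTerm ρ S x p U ∂piHaar S = if p.1 < p.2 then charMean ρ else 0 := by
  unfold plaqTerm
  by_cases h : p.1 < p.2
  · simp only [h, ↓reduceIte]
    exact integral_comp_plaquette S hS (continuous_trace_re ρ hρ) x (ne_of_lt h)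
  · simp [h]

/-- Mean of a product of plaquette terms at distinct base points factorises. [folklore] -/
theorem integral_plaqTerm_mul (hS : (1 : ZMod S) ≠ 0) (hρ : Continuous ρ) {x y : Site 4 S}
    (hxy : x ≠ y) (p q : Fin 4 × Fin 4) :
    ∫ U, plaqTerm ρ S x p U * plaqTerm ρ S y q U ∂piHaar S =
      (if p.1 < p.2 then charMean ρ else 0) * (if q.1 < q.2 then charMean ρ else 0) := by
  unfold plaqTerm
  by_cases hp : p.1 < p.2
  · by_cases hq : q.1 < q.2
    · simp only [hp, hq, ↓reduceIte]
      exact integral_plaquette_mul_plaquette S hS (continuous_trace_re ρ hρ)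
        (continuous_trace_re ρ hρ) hxy (ne_of_lt hp) (ne_of_lt hq)
    · simp [hp, hq]
  · simp [hp]

/-- **Mean of the density**: `∫ D_x = ∑_{i<j} m_ρ` (independent of `x`). [folklore] -/
theorem integral_torusDensity (hS : (1 : ZMod S) ≠ 0) (hρ : Continuous ρ) (x : Site 4 S) :
    ∫ U, torusDensity ρ S x U ∂piHaar S =
      ∑ p : Fin 4 × Fin 4, if p.1 < p.2 then charMean ρ else 0 := by
  simp only [torusDensity_eq_sum]
  rw [integral_finsetSum _ fun p _ => integrable_of_continuous S (continuous_plaqTerm ρ S hρ x p)]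
  exact Finset.sum_congr rfl fun p _ => integral_plaqTerm ρ S hS hρ x p

/-- **Densities at distinct torus sites are uncorrelated** under product Haar (`β = 0`). [folklore] -/
theorem integral_torusDensity_mul (hS : (1 : ZMod S) ≠ 0) (hρ : Continuous ρ) {x y : Site 4 S}
    (hxy : x ≠ y) :
    ∫ U, torusDensity ρ S x U * torusDensity ρ S y U ∂piHaar S =
      (∫ U, torusDensity ρ S x U ∂piHaar S) * ∫ U, torusDensity ρ S y U ∂piHaar S := by
  rw [integral_torusDensity ρ S hS hρ x, integral_torusDensity ρ S hS hρ y, Finset.sum_mul_sum]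
  simp only [torusDensity_eq_sum, Finset.sum_mul_sum]
  rw [integral_finsetSum _ fun p _ => ?_]
  · refine Finset.sum_congr rfl fun p _ => ?_
    rw [integral_finsetSum _ fun q _ => ?_]
    · exact Finset.sum_congr rfl fun q _ => integral_plaqTerm_mul ρ S hS hρ hxy p q
    · exact integrable_of_continuous S
        ((continuous_plaqTerm ρ S hρ x p).mul (continuous_plaqTerm ρ S hρ y q))
  · exact integrable_finsetSum _ fun q _ => integrable_of_continuous S
      ((continuous_plaqTerm ρ S hρ x p).mul (continuous_plaqTerm ρ S hρ y q))

end Correlator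

end

end Summit.QuantumFields.YangMills.Theorems.ContinuumLimitOnTrajectory.Negative
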